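import Summits.Ventures.DiscreteObjects.Hadamard.ConferenceGraph333KleinFour
import Summits.Ventures.DiscreteObjects.Hadamard.ConferenceGraph333InvolutionSummaryG31

/-!
# Four-groups inverting an element of order `83`, `41`, `37` of Aut(srg(333,166,82,83)): fixed-point patterns (kernel)

Framing: lottery ticket; floor = certified bounds/negative ranges.  Cell pub-namedobj (venture DiscreteObjects),
target (H) = `H(668)`, hadamard gen 32.  Corollaries of the four-group law `#Fix τ₁ + #Fix τ₂ + #Fix τ₁τ₂ ≡ 7 (mod 8)`
(`ConferenceGraph333KleinFour`) with the gen-30/31 facts on involutions centralising / inverting an element `ρ` of prime order: if two distinct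
commuting involutions `τ₁, τ₂` both invert `ρ` (`ρ τᵢ ρ = τᵢ`), their product centralises `ρ`, so
* **`klein_four_inverting_order83`** — `ρ` of order `83`: `#Fix (τ₁τ₂) = 1` and `{#Fix τ₁, #Fix τ₂} = {1, 5}` (one of each);
* **`klein_four_inverting_order41`** — order `41`: `#Fix (τ₁τ₂) = 1` and exactly one of `#Fix τ₁, #Fix τ₂` is `≡ 5 (mod 8)`
  (i.e. one lies in `{1, 9}`, the other in `{5, 13}`);
* **`klein_four_inverting_order37`** — order `37`: `#Fix (τ₁τ₂) = 37` and `#Fix τ₁ ≡ #Fix τ₂ (mod 8)` (`(1,1), (1,9), (9,1), (9,9)` or `(5,5)`).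
(For `83` such a four-group generates with `ρ` the full normaliser of order `332`, `ConferenceGraph333Normalizer83Index`.)
WORDS: structure of a HYPOTHETICAL object; ours (PROVISIONAL).  No `sorry`, no new definitions.
-/

namespace Summit.Ventures.DiscreteObjects.Hadamard

open Finset

section kleinfournorm
variable {V : Type*} [Fintype V] [DecidableEq V]

omit [Fintype V] [DecidableEq V] in
/-- two involutions inverting `ρ` have a product commuting with `ρ` -/
theorem inverting_pair_product_commutes (ρ τ₁ τ₂ : Equiv.Perm V) (hc1 : ρ * τ₁ * ρ = τ₁)
    (hc2 : ρ * τ₂ * ρ = τ₂) : ρ * (τ₁ * τ₂) = τ₁ * τ₂ * ρ := by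
  -- ρ τ₁ ρ = τ₁ ⇒ ρ τ₁ = τ₁ ρ⁻¹, and ρ τ₂ ρ = τ₂ ⇒ ρ⁻¹ τ₂ = τ₂ ρ
  have e1 : ρ * τ₁ = τ₁ * ρ⁻¹ := by
    calc ρ * τ₁ = ρ * τ₁ * ρ * ρ⁻¹ := by rw [mul_inv_cancel_right]
      _ = τ₁ * ρ⁻¹ := by rw [hc1]
  have e2 : ρ⁻¹ * τ₂ = τ₂ * ρ := by
    calc ρ⁻¹ * τ₂ = ρ⁻¹ * (ρ * τ₂ * ρ) := by rw [hc2]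
      _ = τ₂ * ρ := by rw [← mul_assoc, ← mul_assoc, inv_mul_cancel, one_mul]
  calc ρ * (τ₁ * τ₂) = ρ * τ₁ * τ₂ := by rw [mul_assoc]
    _ = τ₁ * ρ⁻¹ * τ₂ := by rw [e1]
    _ = τ₁ * (ρ⁻¹ * τ₂) := by rw [mul_assoc]
    _ = τ₁ * τ₂ * ρ := by rw [e2, mul_assoc]

/-- **Four-groups inverting `ρ₈₃`**: the product fixes one vertex, and the two inverting involutions fix `1` and `5` vertices (one each). -/
theorem klein_four_inverting_order83 (hV : Fintype.card V = 333) (A : Matrix V V ℤ)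
    (h01 : ∀ x y, A x y = 0 ∨ A x y = 1) (hsymm : ∀ x y, A y x = A x y) (hdiag : ∀ x, A x x = 0)
    (hk : ∀ x, ∑ y, A x y = 166) (hsrg : ∀ x y, ∑ z, A x z * A z y = 83 * (1 + (if x = y then 1 else 0)) - A x y)
    (ρ τ₁ τ₂ : Equiv.Perm V) (hρ : ρ ^ 83 = 1) (hρ1 : ρ ≠ 1) (h1 : τ₁ ^ 2 = 1) (h2 : τ₂ ^ 2 = 1) (hτ₁ : τ₁ ≠ 1) (hτ₂ : τ₂ ≠ 1)
    (hne : τ₁ ≠ τ₂) (hc12 : τ₁ * τ₂ = τ₂ * τ₁) (hi1 : ρ * τ₁ * ρ = τ₁) (hi2 : ρ * τ₂ * ρ = τ₂)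
    (hAρ : ∀ x y, A (ρ x) (ρ y) = A x y) (hA1 : ∀ x y, A (τ₁ x) (τ₁ y) = A x y) (hA2 : ∀ x y, A (τ₂ x) (τ₂ y) = A x y) :
    (univ.filter fun x => (τ₁ * τ₂) x = x).card = 1 ∧
    (((univ.filter fun x => τ₁ x = x).card = 1 ∧ (univ.filter fun x => τ₂ x = x).card = 5) ∨
     ((univ.filter fun x => τ₁ x = x).card = 5 ∧ (univ.filter fun x => τ₂ x = x).card = 1)) := by
  have hsum := klein_four_fixed_sum_mod_eight hV A h01 hsymm hdiag hk hsrg τ₁ τ₂ h1 h2 hτ₁ hτ₂ hne hc12 hA1 hA2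
  have hinv : ∀ γ : Equiv.Perm V, γ ^ 2 = 1 → ∀ x, γ (γ x) = x := fun γ h x => by
    have := congrArg (fun g : Equiv.Perm V => g x) h
    simpa [pow_two] using this
  have h11 : τ₁ * τ₁ = 1 := by rw [← pow_two]; exact h1
  have h22 : τ₂ * τ₂ = 1 := by rw [← pow_two]; exact h2
  have hp2 : (τ₁ * τ₂) ^ 2 = 1 := by
    rw [pow_two, show τ₁ * τ₂ * (τ₁ * τ₂) = τ₁ * (τ₂ * τ₁) * τ₂ by simp only [mul_assoc], ← hc12, ← mul_assoc, h11,
      one_mul, h22]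
  have hp1 : τ₁ * τ₂ ≠ 1 := by
    intro h; apply hne
    calc τ₁ = τ₁ * (τ₂ * τ₂) := by rw [h22, mul_one]
      _ = τ₁ * τ₂ * τ₂ := by rw [mul_assoc]
      _ = τ₂ := by rw [h, one_mul]
  have hAp : ∀ x y, A ((τ₁ * τ₂) x) ((τ₁ * τ₂) y) = A x y := fun x y => by
    rw [Equiv.Perm.mul_apply, Equiv.Perm.mul_apply, hA1, hA2]
  have hcp := inverting_pair_product_commutes ρ τ₁ τ₂ hi1 hi2
  have fp := involution_centralizing_order83_fixed_one hV A h01 hsymm hdiag hk hsrg ρ (τ₁ * τ₂) hρ hρ1 hp2 hp1 hcp hAρ hAp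
  have f1 := involution_inverting_order83_fixed hV A h01 hsymm hdiag hk hsrg ρ τ₁ hρ hρ1 (hinv τ₁ h1) hi1 hAρ hA1
  have f2 := involution_inverting_order83_fixed hV A h01 hsymm hdiag hk hsrg ρ τ₂ hρ hρ1 (hinv τ₂ h2) hi2 hAρ hA2
  refine ⟨fp, ?_⟩
  rw [fp] at hsum
  omega

/-- **Four-groups inverting `ρ₄₁`**: the product fixes one vertex; of the two inverting involutions exactly one fixes `≡ 5 (mod 8)`
vertices (`#Fix ∈ {1,5,9,13}` each). -/
theorem klein_four_inverting_order41 (hV : Fintype.card V = 333) (A : Matrix V V ℤ)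
    (h01 : ∀ x y, A x y = 0 ∨ A x y = 1) (hsymm : ∀ x y, A y x = A x y) (hdiag : ∀ x, A x x = 0)
    (hk : ∀ x, ∑ y, A x y = 166) (hsrg : ∀ x y, ∑ z, A x z * A z y = 83 * (1 + (if x = y then 1 else 0)) - A x y)
    (ρ τ₁ τ₂ : Equiv.Perm V) (hρ : ρ ^ 41 = 1) (hρ1 : ρ ≠ 1) (h1 : τ₁ ^ 2 = 1) (h2 : τ₂ ^ 2 = 1) (hτ₁ : τ₁ ≠ 1) (hτ₂ : τ₂ ≠ 1)
    (hne : τ₁ ≠ τ₂) (hc12 : τ₁ * τ₂ = τ₂ * τ₁) (hi1 : ρ * τ₁ * ρ = τ₁) (hi2 : ρ * τ₂ * ρ = τ₂)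
    (hAρ : ∀ x y, A (ρ x) (ρ y) = A x y) (hA1 : ∀ x y, A (τ₁ x) (τ₁ y) = A x y) (hA2 : ∀ x y, A (τ₂ x) (τ₂ y) = A x y) :
    (univ.filter fun x => (τ₁ * τ₂) x = x).card = 1 ∧
    (((univ.filter fun x => τ₁ x = x).card % 8 = 1 ∧ (univ.filter fun x => τ₂ x = x).card % 8 = 5) ∨
     ((univ.filter fun x => τ₁ x = x).card % 8 = 5 ∧ (univ.filter fun x => τ₂ x = x).card % 8 = 1)) := by
  have hsum := klein_four_fixed_sum_mod_eight hV A h01 hsymm hdiag hk hsrg τ₁ τ₂ h1 h2 hτ₁ hτ₂ hne hc12 hA1 hA2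
  have hinv : ∀ γ : Equiv.Perm V, γ ^ 2 = 1 → ∀ x, γ (γ x) = x := fun γ h x => by
    have := congrArg (fun g : Equiv.Perm V => g x) h
    simpa [pow_two] using this
  have h11 : τ₁ * τ₁ = 1 := by rw [← pow_two]; exact h1
  have h22 : τ₂ * τ₂ = 1 := by rw [← pow_two]; exact h2
  have hp2 : (τ₁ * τ₂) ^ 2 = 1 := by
    rw [pow_two, show τ₁ * τ₂ * (τ₁ * τ₂) = τ₁ * (τ₂ * τ₁) * τ₂ by simp only [mul_assoc], ← hc12, ← mul_assoc, h11,
      one_mul, h22]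
  have hp1 : τ₁ * τ₂ ≠ 1 := by
    intro h; apply hne
    calc τ₁ = τ₁ * (τ₂ * τ₂) := by rw [h22, mul_one]
      _ = τ₁ * τ₂ * τ₂ := by rw [mul_assoc]
      _ = τ₂ := by rw [h, one_mul]
  have hAp : ∀ x y, A ((τ₁ * τ₂) x) ((τ₁ * τ₂) y) = A x y := fun x y => by
    rw [Equiv.Perm.mul_apply, Equiv.Perm.mul_apply, hA1, hA2]
  have hcp := inverting_pair_product_commutes ρ τ₁ τ₂ hi1 hi2
  have fp := (involution_centralizing_order41_fixed_one hV A h01 hsymm hdiag hk hsrg ρ (τ₁ * τ₂) hρ hρ1 hp2 hp1 hcp hAρ hAp).1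
  have f1 := involution_inverting_order41_fixed hV A h01 hsymm hdiag hk hsrg ρ τ₁ hρ hρ1 (hinv τ₁ h1) hi1 hAρ hA1
  have f2 := involution_inverting_order41_fixed hV A h01 hsymm hdiag hk hsrg ρ τ₂ hρ hρ1 (hinv τ₂ h2) hi2 hAρ hA2
  refine ⟨fp, ?_⟩
  rw [fp] at hsum
  omega

/-- **Four-groups inverting `ρ₃₇`**: the product fixes `37` vertices (one `ρ`-orbit); the two inverting involutions fix congruent numbers of
vertices mod `8` (`#Fix ∈ {1,5,9}` each: `(1,1)`, `(1,9)`, `(9,1)`, `(9,9)` or `(5,5)`). -/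
theorem klein_four_inverting_order37 (hV : Fintype.card V = 333) (A : Matrix V V ℤ)
    (h01 : ∀ x y, A x y = 0 ∨ A x y = 1) (hsymm : ∀ x y, A y x = A x y) (hdiag : ∀ x, A x x = 0)
    (hk : ∀ x, ∑ y, A x y = 166) (hsrg : ∀ x y, ∑ z, A x z * A z y = 83 * (1 + (if x = y then 1 else 0)) - A x y)
    (ρ τ₁ τ₂ : Equiv.Perm V) (hρ : ρ ^ 37 = 1) (hρ1 : ρ ≠ 1) (h1 : τ₁ ^ 2 = 1) (h2 : τ₂ ^ 2 = 1) (hτ₁ : τ₁ ≠ 1) (hτ₂ : τ₂ ≠ 1)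
    (hne : τ₁ ≠ τ₂) (hc12 : τ₁ * τ₂ = τ₂ * τ₁) (hi1 : ρ * τ₁ * ρ = τ₁) (hi2 : ρ * τ₂ * ρ = τ₂)
    (hAρ : ∀ x y, A (ρ x) (ρ y) = A x y) (hA1 : ∀ x y, A (τ₁ x) (τ₁ y) = A x y) (hA2 : ∀ x y, A (τ₂ x) (τ₂ y) = A x y) :
    (univ.filter fun x => (τ₁ * τ₂) x = x).card = 37 ∧
    (univ.filter fun x => τ₁ x = x).card % 8 = (univ.filter fun x => τ₂ x = x).card % 8 := by
  have hsum := klein_four_fixed_sum_mod_eight hV A h01 hsymm hdiag hk hsrg τ₁ τ₂ h1 h2 hτ₁ hτ₂ hne hc12 hA1 hA2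
  have hinv : ∀ γ : Equiv.Perm V, γ ^ 2 = 1 → ∀ x, γ (γ x) = x := fun γ h x => by
    have := congrArg (fun g : Equiv.Perm V => g x) h
    simpa [pow_two] using this
  have h11 : τ₁ * τ₁ = 1 := by rw [← pow_two]; exact h1
  have h22 : τ₂ * τ₂ = 1 := by rw [← pow_two]; exact h2
  have hp2 : (τ₁ * τ₂) ^ 2 = 1 := by
    rw [pow_two, show τ₁ * τ₂ * (τ₁ * τ₂) = τ₁ * (τ₂ * τ₁) * τ₂ by simp only [mul_assoc], ← hc12, ← mul_assoc, h11,
      one_mul, h22]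
  have hp1 : τ₁ * τ₂ ≠ 1 := by
    intro h; apply hne
    calc τ₁ = τ₁ * (τ₂ * τ₂) := by rw [h22, mul_one]
      _ = τ₁ * τ₂ * τ₂ := by rw [mul_assoc]
      _ = τ₂ := by rw [h, one_mul]
  have hAp : ∀ x y, A ((τ₁ * τ₂) x) ((τ₁ * τ₂) y) = A x y := fun x y => by
    rw [Equiv.Perm.mul_apply, Equiv.Perm.mul_apply, hA1, hA2]
  have hcp := inverting_pair_product_commutes ρ τ₁ τ₂ hi1 hi2
  have fp := involution_centralizing_order37_fixed hV A h01 hsymm hdiag hk hsrg ρ (τ₁ * τ₂) hρ hρ1 hp2 hp1 hcp hAρ hAp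
  have f1 := involution_inverting_order37_fixed hV A h01 hsymm hdiag hk hsrg ρ τ₁ hρ hρ1 (hinv τ₁ h1) hi1 hAρ hA1
  have f2 := involution_inverting_order37_fixed hV A h01 hsymm hdiag hk hsrg ρ τ₂ hρ hρ1 (hinv τ₂ h2) hi2 hAρ hA2
  refine ⟨fp, ?_⟩
  rw [fp] at hsum
  omega

end kleinfournorm

end Summit.Ventures.DiscreteObjects.Hadamard
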